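import Summits.NavierStokesRegularity.NavierStokesRegularity.Theorems.FilamentSkeletonRssDefectColumnGateBorderedAssemblyRange
import Summits.NavierStokesRegularity.NavierStokesRegularity.Theorems.FilamentSkeletonRssDefectColumnGatePerturbBase

/-!
# Route `FilamentSkeletonRss` · ∀-support item `TransverseReduction1ARmod` (stmt-NavierStokesRegularity-23920) · line `defect_column_gate_1AR_mod`,
# stub S2b-mod `GateAssemblyLocMod`: the CONTINUITY METHOD for bordered gates — free end + uniform a-priori bound along a base chain ⇒ gate

Helper file (theorems only), `--supports stmt-NavierStokesRegularity-23920 --as helper` (also serves 23611); LEAD of 23611 / registrar of 23920,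
lane ns-filament-21221-p1 g14.

ARCHITECTURE OF S2b-mod (LEAD, recorded as kernel-checked bookkeeping; the analysis stays OPEN).  The bordered gate `DefectGateSpecAcc` at the dressed base
`U⁰` (borders: rate column `Z`, accretion modes `D_1…D_N`) is reached from a base `U_0` where a bordered gate is at hand (the FREE end: `…KelvinGateFreeResolvent`
+ `…FreeKernel`, borders entering through an `(N+1)×(N+1)` Grushin matrix) along a finite chain `U_{k+1} = U_k + V_k` of X-small steps (`8·CΓ^κ·ν ≤ 1`):
* `DefectGateSpecAcc.perturb_base_range` — one step (`…PerturbBase` with the Neumann data map `Nop` EXPOSED: new gate = old gate ∘ `Nop`, so every RANGE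
  property `Cob p β (𝓚G) (𝓠G)` of the old outputs — co-border conditions, pressure normalisation, symmetry — transfers verbatim);
* `DefectGateSpecAcc.of_apriori` — CONSTANT RESET: a gate whose outputs satisfy `Cob`, at a base where every `Cob`-solution of the bordered system obeys an
  a-priori bound with constant `C′`, satisfies the spec with constant `C′` (the doubling of each step is undone; clauses (2)–(4) untouched);
* `DefectGateSpecAcc.chain` — induction: gate with `Cob`-range at `U_0` + the a-priori bound under `Cob` at every `U_k` (UNIFORM constant `C`) + X-small,
  locally continuous steps ⇒ gate with `Cob`-range and constant `C` at `U_n`, ALL FOUR clauses.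
So S2b-mod = (S2b-free) a bordered gate at the free end whose outputs satisfy the chosen co-border conditions `Cob` + (S2b-apriori) the UNIFORM a-priori
bound for `Cob`-solutions of the bordered system along the chain — this is where S2a-loc's sectional bound, the axial solvability files and the patching
calculus (`…KelvinGateCutoff`) enter — + (S2b-chain) an X-Lipschitz, locally continuous chain from the free base to `U⁰` inside the class where the a-priori
bound holds.  The choice of the chain and of `Cob` is the analyst's; nothing here constrains it.
HONEST FRAMING: functional-analytic bookkeeping for a HYPOTHETICAL filament-type rotating-self-similar blow-up route (MODEL rung, negative side, SUPPORT
item); the a-priori bound and the free bordered gate are NOT proved here; nothing here bears on Navier–Stokes regularity, which is NOT proved.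
-/

set_option linter.dupNamespace false

noncomputable section

namespace Summit.NavierStokesRegularity.NavierStokesRegularity.Theorems.DefectColumnGate

open scoped BigOperators Topology InnerProductSpace ContDiff
open Filter Set Function MeasureTheory Metric
open Literature.Analysis.FluidPDE
open Summit.NavierStokesRegularity.NavierStokesRegularity.Theorems.KelvinGate

/-- **One X-small step of the base, range form.**  As `DefectGateSpecAcc.perturb_base`, with the data map exposed: there is `Nop` on the box with
`Y(Nop F) ≤ 2·Y(F)` such that `(𝓚 ∘ Nop, 𝓠 ∘ Nop, 𝓫 ∘ Nop, 𝓬 ∘ Nop)` satisfies `DefectGateSpecAcc N Γ κ (2C₂) β₀ α0 (U⁰ + V) Z D`. -/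
theorem DefectGateSpecAcc.perturb_base_range {N : ℕ} {Γ κ C₂ β₀ ν : ℝ} {α0 : (Fin N → ℝ) → ℝ}
    {U0 V Z : (Fin N → ℝ) → ℝ → EuclideanSpace ℝ (Fin 3) → EuclideanSpace ℝ (Fin 3)} {D : (Fin N → ℝ) → Fin N → EuclideanSpace ℝ (Fin 3) → EuclideanSpace ℝ (Fin 3)}
    {𝓚 : (Fin N → ℝ) → ℝ → (EuclideanSpace ℝ (Fin 3) → EuclideanSpace ℝ (Fin 3)) → EuclideanSpace ℝ (Fin 3) → EuclideanSpace ℝ (Fin 3)}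
    {𝓠 : (Fin N → ℝ) → ℝ → (EuclideanSpace ℝ (Fin 3) → EuclideanSpace ℝ (Fin 3)) → EuclideanSpace ℝ (Fin 3) → ℝ}
    {𝓫 : (Fin N → ℝ) → ℝ → (EuclideanSpace ℝ (Fin 3) → EuclideanSpace ℝ (Fin 3)) → ℝ}
    {𝓬 : (Fin N → ℝ) → ℝ → (EuclideanSpace ℝ (Fin 3) → EuclideanSpace ℝ (Fin 3)) → Fin N → ℝ}
    (hgate : DefectGateSpecAcc N Γ κ C₂ β₀ α0 U0 Z D 𝓚 𝓠 𝓫 𝓬)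
    (hU0 : ∀ p : Fin N → ℝ, (∀ i, p i ∈ Icc (0:ℝ) 1) → ∀ β : ℝ, |β| ≤ β₀ → Differentiable ℝ (U0 p β))
    (hV : ∀ p : Fin N → ℝ, (∀ i, p i ∈ Icc (0:ℝ) 1) → ∀ β : ℝ, |β| ≤ β₀ → XBound (V p β) ν)
    (hν : 8 * (C₂ * Γ ^ κ) * ν ≤ 1)
    (hVc : ∀ p : Fin N → ℝ, (∀ i, p i ∈ Icc (0:ℝ) 1) → ∀ β : ℝ, |β| ≤ β₀ → ∀ L ε : ℝ, 0 < ε → ∃ δ' : ℝ, 0 < δ' ∧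
      ∀ p' : Fin N → ℝ, (∀ i, p' i ∈ Icc (0:ℝ) 1) → ∀ β' : ℝ, |β'| ≤ β₀ → dist p' p < δ' → |β' - β| < δ' → LocClose (V p' β') (V p β) L ε) :
    ∃ Nop : ((Fin N → ℝ) × ℝ) → (EuclideanSpace ℝ (Fin 3) → EuclideanSpace ℝ (Fin 3)) → EuclideanSpace ℝ (Fin 3) → EuclideanSpace ℝ (Fin 3),
      (∀ p : Fin N → ℝ, (∀ i, p i ∈ Icc (0:ℝ) 1) → ∀ β : ℝ, |β| ≤ β₀ →
        ∀ (F : EuclideanSpace ℝ (Fin 3) → EuclideanSpace ℝ (Fin 3)) (R : ℝ), YBound F R → YBound (Nop (p, β) F) (2 * R)) ∧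
      DefectGateSpecAcc N Γ κ (2 * C₂) β₀ α0 (fun p β y => U0 p β y + V p β y) Z D (fun p β F => 𝓚 p β (Nop (p, β) F))
        (fun p β F => 𝓠 p β (Nop (p, β) F)) (fun p β F => 𝓫 p β (Nop (p, β) F)) (fun p β F => 𝓬 p β (Nop (p, β) F)) := by
  obtain ⟨h12, h3, h4⟩ := hgate
  -- shorthand
  set A : ℝ := C₂ * Γ ^ κ with hAdef
  set θ : ℝ := 4 * (C₂ * Γ ^ κ) * ν with hθdef
  have hθ : θ ≤ 1 / 2 := by rw [hθdef]; linarith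
  have hA : 2 * A ≤ 2 * C₂ * Γ ^ κ := by rw [hAdef]; exact le_of_eq (by ring)
  -- the defect `R F := −(D(𝓚F)[V] + DV[𝓚F])`
  set Rm : (Fin N → ℝ) → ℝ → (EuclideanSpace ℝ (Fin 3) → EuclideanSpace ℝ (Fin 3)) → EuclideanSpace ℝ (Fin 3) → EuclideanSpace ℝ (Fin 3) :=
    fun p β F y => -(fderiv ℝ (𝓚 p β F) y (V p β y) + fderiv ℝ (V p β) y (𝓚 p β F y)) with hRm
  refine defectGateSpecAcc_of_approximate_range (U0 := fun p β y => U0 p β y + V p β y) 𝓚 Rm 𝓠 𝓫 𝓬 hA hθ ?_ ?_ ?_ ?_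
  · -- (h1) bounds, divergence, the contracting defect and the equation for the new base
    intro p hp β hβ F R hF
    obtain ⟨hX, hQ1, hQb, hbb, hcb, hdiv, heq⟩ := (h12 p hp β hβ).1 F R hF
    have hVX : XBound (V p β) ν := hV p hp β hβ
    refine ⟨hX, hQ1, hQb, hbb, hcb, hdiv, ?_, fun y => ?_⟩
    · -- `Y(RF) ≤ 4·C₂Γ^κ·ν·R`
      have h1 := hX.yBound_fderiv_apply hVX
      have h2 := hVX.yBound_fderiv_apply hX
      have h := (h1.add h2).neg
      refine h.mono (le_of_eq ?_)
      rw [hθdef]; ring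
    · -- the equation: the base-change term cancels the defect
      have hdU : DifferentiableAt ℝ (U0 p β) y := hU0 p hp β hβ y
      have hdV : DifferentiableAt ℝ (V p β) y := hVX.1.differentiable (by norm_num) y
      have e := lerayLin_add_base (α0 p + β) (U0 p β) (V p β) (𝓚 p β F) y hdU hdV
      show lerayLin (α0 p + β) (fun y => U0 p β y + V p β y) (𝓚 p β F) y + gradient (𝓠 p β F) y + 𝓫 p β F • Z p β y +
          ∑ j, 𝓬 p β F j • D p j y + -(fderiv ℝ (𝓚 p β F) y (V p β y) + fderiv ℝ (V p β) y (𝓚 p β F y)) = F y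
      rw [e, ← heq y]
      abel
  · -- (h2) linearity of `𝓚, 𝓫, 𝓬` (given) and of the defect
    intro p hp β hβ F H s hF hH
    obtain ⟨hK, hb, hc⟩ := (h12 p hp β hβ).2 F H s hF hH
    refine ⟨hK, hb, hc, ?_⟩
    obtain ⟨R, hFR⟩ := hF
    obtain ⟨R', hHR⟩ := hH
    have hXF : XBound (𝓚 p β F) (C₂ * Γ ^ κ * R) := ((h12 p hp β hβ).1 F R hFR).1
    have hXH : XBound (𝓚 p β H) (C₂ * Γ ^ κ * R') := ((h12 p hp β hβ).1 H R' hHR).1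
    funext y
    show -(fderiv ℝ (𝓚 p β (fun y => F y + s • H y)) y (V p β y) + fderiv ℝ (V p β) y (𝓚 p β (fun y => F y + s • H y) y)) =
      -(fderiv ℝ (𝓚 p β F) y (V p β y) + fderiv ℝ (V p β) y (𝓚 p β F y)) +
        s • -(fderiv ℝ (𝓚 p β H) y (V p β y) + fderiv ℝ (V p β) y (𝓚 p β H y))
    rw [hK]
    have hdF : DifferentiableAt ℝ (𝓚 p β F) y := hXF.1.differentiable (by norm_num) y
    have hdH : DifferentiableAt ℝ (𝓚 p β H) y := hXH.1.differentiable (by norm_num) y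
    have hdsH : DifferentiableAt ℝ (fun y => s • 𝓚 p β H y) y := hdH.fun_const_smul s
    show -(fderiv ℝ (fun y => 𝓚 p β F y + s • 𝓚 p β H y) y (V p β y) + fderiv ℝ (V p β) y (𝓚 p β F y + s • 𝓚 p β H y)) =
      -(fderiv ℝ (𝓚 p β F) y (V p β y) + fderiv ℝ (V p β) y (𝓚 p β F y)) +
        s • -(fderiv ℝ (𝓚 p β H) y (V p β y) + fderiv ℝ (V p β) y (𝓚 p β H y))
    rw [fderiv_fun_add hdF hdsH, fderiv_fun_const_smul hdH]
    have e3 : (fderiv ℝ (𝓚 p β F) y + s • fderiv ℝ (𝓚 p β H) y) (V p β y) =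
        fderiv ℝ (𝓚 p β F) y (V p β y) + s • fderiv ℝ (𝓚 p β H) y (V p β y) := rfl
    rw [e3, map_add, map_smul, smul_neg, smul_add]
    abel
  · -- (h3) tightness: the gate's, plus `|RF| ≤ 2ν·ε₁` on the ball
    intro R L ε hε
    set ε₁ : ℝ := ε / (2 * |ν| + 1) with hε₁
    have hden : 0 < 2 * |ν| + 1 := by positivity
    have hε₁pos : 0 < ε₁ := div_pos hε hden
    have hε₁le : ε₁ ≤ ε := by
      rw [hε₁, div_le_iff₀ hden]; nlinarith [abs_nonneg ν]
    have h2νε₁ : 2 * |ν| * ε₁ ≤ ε := by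
      rw [hε₁, mul_div_assoc', div_le_iff₀ hden]; nlinarith [abs_nonneg ν]
    obtain ⟨L', δ₀, hδ₀, h3'⟩ := h3 R L ε₁ hε₁pos
    refine ⟨L', δ₀, hδ₀, fun p hp β hβ F hF hsm => ?_⟩
    obtain ⟨hK, hb, hc⟩ := h3' p hp β hβ F hF hsm
    have hVX : XBound (V p β) ν := hV p hp β hβ
    have hν0 : 0 ≤ ν := hVX.nonneg
    have hνa : ν = |ν| := (abs_of_nonneg hν0).symm
    refine ⟨fun y hy => ⟨(hK y hy).1.trans hε₁le, (hK y hy).2.trans hε₁le⟩, hb.trans hε₁le, fun j => (hc j).trans hε₁le, fun y hy => ?_⟩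
    show ‖-(fderiv ℝ (𝓚 p β F) y (V p β y) + fderiv ℝ (V p β) y (𝓚 p β F y))‖ ≤ ε
    rw [norm_neg]
    calc ‖fderiv ℝ (𝓚 p β F) y (V p β y) + fderiv ℝ (V p β) y (𝓚 p β F y)‖
        ≤ ‖fderiv ℝ (𝓚 p β F) y‖ * ν + ν * ‖𝓚 p β F y‖ := norm_baseChange_le hVX y
      _ ≤ ε₁ * ν + ν * ε₁ := add_le_add (mul_le_mul_of_nonneg_right (hK y hy).2 hν0) (mul_le_mul_of_nonneg_left (hK y hy).1 hν0)
      _ = 2 * |ν| * ε₁ := by rw [← hνa]; ring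
      _ ≤ ε := h2νε₁
  · -- (h4) local continuity in `(p, β)`: the gate's, plus the four-term splitting for the defect
    intro p hp β hβ F R L ε hF hε
    have hVX : XBound (V p β) ν := hV p hp β hβ
    have hν0 : 0 ≤ ν := hVX.nonneg
    have hXF : XBound (𝓚 p β F) (A * R) := ((h12 p hp β hβ).1 F R hF).1
    have hAR : 0 ≤ A * R := hXF.nonneg
    set ε₁ : ℝ := ε / (4 * ν + 1) with hε₁
    set ε₂ : ℝ := ε / (4 * (A * R) + 1) with hε₂
    have hd1 : 0 < 4 * ν + 1 := by linarith
    have hd2 : 0 < 4 * (A * R) + 1 := by linarith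
    have hε₁pos : 0 < ε₁ := div_pos hε hd1
    have hε₂pos : 0 < ε₂ := div_pos hε hd2
    have hε₁le : ε₁ ≤ ε := by rw [hε₁, div_le_iff₀ hd1]; nlinarith
    have hνε₁ : 2 * ν * ε₁ ≤ ε / 2 := by
      rw [hε₁, mul_div_assoc', div_le_iff₀ hd1]; nlinarith
    have hAε₂ : 2 * (A * R) * ε₂ ≤ ε / 2 := by
      rw [hε₂, mul_div_assoc', div_le_iff₀ hd2]; nlinarith
    obtain ⟨δ₁, hδ₁, h4'⟩ := h4 p hp β hβ F R L ε₁ hF hε₁pos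
    obtain ⟨δ₂, hδ₂, hVc'⟩ := hVc p hp β hβ L ε₂ hε₂pos
    refine ⟨min δ₁ δ₂, lt_min hδ₁ hδ₂, fun p' hp' β' hβ' hdp hdβ => ?_⟩
    obtain ⟨hK, hb, hc⟩ := h4' p' hp' β' hβ' (hdp.trans_le (min_le_left _ _)) (hdβ.trans_le (min_le_left _ _))
    have hVl := hVc' p' hp' β' hβ' (hdp.trans_le (min_le_right _ _)) (hdβ.trans_le (min_le_right _ _))
    have hVX' : XBound (V p' β') ν := hV p' hp' β' hβ'
    have hXF' : XBound (𝓚 p' β' F) (A * R) := ((h12 p' hp' β' hβ').1 F R hF).1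
    refine ⟨fun y hy => ⟨(hK y hy).1.trans hε₁le, (hK y hy).2.trans hε₁le⟩, hb.trans hε₁le, fun j => (hc j).trans hε₁le, fun y hy => ?_⟩
    show ‖-(fderiv ℝ (𝓚 p' β' F) y (V p' β' y) + fderiv ℝ (V p' β') y (𝓚 p' β' F y)) -
        -(fderiv ℝ (𝓚 p β F) y (V p β y) + fderiv ℝ (V p β) y (𝓚 p β F y))‖ ≤ ε
    rw [neg_sub_neg, norm_sub_rev]
    obtain ⟨hKv, hKd⟩ := hK y hy
    obtain ⟨hVv, hVd⟩ := hVl y hy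
    obtain ⟨hv', -⟩ := hVX'.norm_le' y
    obtain ⟨-, hdv⟩ := hVX.norm_le' y
    obtain ⟨hk', -⟩ := hXF'.norm_le' y
    obtain ⟨-, hdk⟩ := hXF.norm_le' y
    calc ‖(fderiv ℝ (𝓚 p' β' F) y (V p' β' y) + fderiv ℝ (V p' β') y (𝓚 p' β' F y)) -
            (fderiv ℝ (𝓚 p β F) y (V p β y) + fderiv ℝ (V p β) y (𝓚 p β F y))‖
        ≤ ‖fderiv ℝ (𝓚 p' β' F) y - fderiv ℝ (𝓚 p β F) y‖ * ‖V p' β' y‖ + ‖fderiv ℝ (𝓚 p β F) y‖ * ‖V p' β' y - V p β y‖ +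
            ‖fderiv ℝ (V p' β') y - fderiv ℝ (V p β) y‖ * ‖𝓚 p' β' F y‖ + ‖fderiv ℝ (V p β) y‖ * ‖𝓚 p' β' F y - 𝓚 p β F y‖ :=
          norm_baseChange_sub_le _ _ _ _ y
      _ ≤ ε₁ * ν + (A * R) * ε₂ + ε₂ * (A * R) + ν * ε₁ := by
          gcongr
      _ = 2 * ν * ε₁ + 2 * (A * R) * ε₂ := by ring
      _ ≤ ε / 2 + ε / 2 := add_le_add hνε₁ hAε₂
      _ = ε := by ring


/-- **Constant reset from an a-priori bound.**  If `(𝓚, 𝓠, 𝓫, 𝓬)` satisfies the bordered spec with SOME constant `C`, its outputs satisfy a range predicate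
`Cob p β (𝓚F) (𝓠F)`, and at every `(p, β)` of the box every `Cob`-solution `(W, Q, b, c)` of the bordered system `𝓛W + ∇Q + b·Z + Σ_j c_j·D_j = F`,
`div W = 0`, `W ∈ X`, `Q ∈ C¹`, obeys the a-priori bound with constant `C′Γ^κ·Y(F)`, then the SAME operators satisfy the spec with constant `C′`. -/
theorem DefectGateSpecAcc.of_apriori {N : ℕ} {Γ κ C C' β₀ : ℝ} {α0 : (Fin N → ℝ) → ℝ}
    {U0 Z : (Fin N → ℝ) → ℝ → EuclideanSpace ℝ (Fin 3) → EuclideanSpace ℝ (Fin 3)} {D : (Fin N → ℝ) → Fin N → EuclideanSpace ℝ (Fin 3) → EuclideanSpace ℝ (Fin 3)}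
    {𝓚 : (Fin N → ℝ) → ℝ → (EuclideanSpace ℝ (Fin 3) → EuclideanSpace ℝ (Fin 3)) → EuclideanSpace ℝ (Fin 3) → EuclideanSpace ℝ (Fin 3)}
    {𝓠 : (Fin N → ℝ) → ℝ → (EuclideanSpace ℝ (Fin 3) → EuclideanSpace ℝ (Fin 3)) → EuclideanSpace ℝ (Fin 3) → ℝ}
    {𝓫 : (Fin N → ℝ) → ℝ → (EuclideanSpace ℝ (Fin 3) → EuclideanSpace ℝ (Fin 3)) → ℝ}
    {𝓬 : (Fin N → ℝ) → ℝ → (EuclideanSpace ℝ (Fin 3) → EuclideanSpace ℝ (Fin 3)) → Fin N → ℝ}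
    (hgate : DefectGateSpecAcc N Γ κ C β₀ α0 U0 Z D 𝓚 𝓠 𝓫 𝓬)
    (Cob : (Fin N → ℝ) → ℝ → (EuclideanSpace ℝ (Fin 3) → EuclideanSpace ℝ (Fin 3)) → (EuclideanSpace ℝ (Fin 3) → ℝ) → Prop)
    (hrange : ∀ p : Fin N → ℝ, (∀ i, p i ∈ Icc (0:ℝ) 1) → ∀ β : ℝ, |β| ≤ β₀ → ∀ F : EuclideanSpace ℝ (Fin 3) → EuclideanSpace ℝ (Fin 3), (∃ R, YBound F R) → Cob p β (𝓚 p β F) (𝓠 p β F))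
    (hap : ∀ p : Fin N → ℝ, (∀ i, p i ∈ Icc (0:ℝ) 1) → ∀ β : ℝ, |β| ≤ β₀ →
      ∀ (W : EuclideanSpace ℝ (Fin 3) → EuclideanSpace ℝ (Fin 3)) (Q : EuclideanSpace ℝ (Fin 3) → ℝ) (b : ℝ) (c : Fin N → ℝ) (F : EuclideanSpace ℝ (Fin 3) → EuclideanSpace ℝ (Fin 3)) (R : ℝ),
        YBound F R → (∃ R', XBound W R') → ContDiff ℝ 1 Q → Cob p β W Q → VectorCalculus.IsDivFree W →
        (∀ y, lerayLin (α0 p + β) (U0 p β) W y + gradient Q y + b • Z p β y + ∑ j, c j • D p j y = F y) →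
        XBound W (C' * Γ ^ κ * R) ∧ (∀ y, |Q y| ≤ C' * Γ ^ κ * R) ∧ |b| ≤ C' * Γ ^ κ * R ∧ ∀ j, |c j| ≤ C' * Γ ^ κ * R) :
    DefectGateSpecAcc N Γ κ C' β₀ α0 U0 Z D 𝓚 𝓠 𝓫 𝓬 := by
  obtain ⟨h12, h3, h4⟩ := hgate
  refine ⟨fun p hp β hβ => ⟨fun F R hF => ?_, (h12 p hp β hβ).2⟩, h3, h4⟩
  obtain ⟨hX, hQ1, -, -, -, hdiv, heq⟩ := (h12 p hp β hβ).1 F R hF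
  obtain ⟨hX', hQ', hb', hc'⟩ :=
    hap p hp β hβ (𝓚 p β F) (𝓠 p β F) (𝓫 p β F) (𝓬 p β F) F R hF ⟨_, hX⟩ hQ1 (hrange p hp β hβ F ⟨R, hF⟩) hdiv heq
  exact ⟨hX', hQ1, hQ', hb', hc', hdiv, heq⟩

/-- **The continuity method along a finite chain of bases.**  Bases `U_0, …, U_n` on the box with X-small, locally continuous steps `U_{k+1} = U_k + V_k`
(`Y`-contraction needs `8·CΓ^κ·ν ≤ 1`), a bordered gate at `U_0` with constant `C` whose outputs satisfy the range predicate `Cob`, and the a-priori bound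
with the SAME constant `C` for `Cob`-solutions of the bordered system at EVERY `U_k`: then `U_n` carries a bordered gate with constant `C`, all four
clauses, outputs again satisfying `Cob`. -/
theorem DefectGateSpecAcc.chain {N : ℕ} {Γ κ C ν β₀ : ℝ} {α0 : (Fin N → ℝ) → ℝ}
    {Z : (Fin N → ℝ) → ℝ → EuclideanSpace ℝ (Fin 3) → EuclideanSpace ℝ (Fin 3)} {D : (Fin N → ℝ) → Fin N → EuclideanSpace ℝ (Fin 3) → EuclideanSpace ℝ (Fin 3)}
    (U V : ℕ → (Fin N → ℝ) → ℝ → EuclideanSpace ℝ (Fin 3) → EuclideanSpace ℝ (Fin 3)) (n : ℕ)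
    (Cob : (Fin N → ℝ) → ℝ → (EuclideanSpace ℝ (Fin 3) → EuclideanSpace ℝ (Fin 3)) → (EuclideanSpace ℝ (Fin 3) → ℝ) → Prop)
    (hstep : ∀ k, k < n → ∀ p : Fin N → ℝ, (∀ i, p i ∈ Icc (0:ℝ) 1) → ∀ β : ℝ, |β| ≤ β₀ → ∀ y, U (k + 1) p β y = U k p β y + V k p β y)
    (hU0 : ∀ p : Fin N → ℝ, (∀ i, p i ∈ Icc (0:ℝ) 1) → ∀ β : ℝ, |β| ≤ β₀ → Differentiable ℝ (U 0 p β))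
    (hV : ∀ k, k < n → ∀ p : Fin N → ℝ, (∀ i, p i ∈ Icc (0:ℝ) 1) → ∀ β : ℝ, |β| ≤ β₀ → XBound (V k p β) ν)
    (hν : 8 * (C * Γ ^ κ) * ν ≤ 1)
    (hVc : ∀ k, k < n → ∀ p : Fin N → ℝ, (∀ i, p i ∈ Icc (0:ℝ) 1) → ∀ β : ℝ, |β| ≤ β₀ → ∀ L ε : ℝ, 0 < ε → ∃ δ' : ℝ, 0 < δ' ∧
      ∀ p' : Fin N → ℝ, (∀ i, p' i ∈ Icc (0:ℝ) 1) → ∀ β' : ℝ, |β'| ≤ β₀ → dist p' p < δ' → |β' - β| < δ' → LocClose (V k p' β') (V k p β) L ε)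
    (hap : ∀ k, k ≤ n → ∀ p : Fin N → ℝ, (∀ i, p i ∈ Icc (0:ℝ) 1) → ∀ β : ℝ, |β| ≤ β₀ →
      ∀ (W : EuclideanSpace ℝ (Fin 3) → EuclideanSpace ℝ (Fin 3)) (Q : EuclideanSpace ℝ (Fin 3) → ℝ) (b : ℝ) (c : Fin N → ℝ) (F : EuclideanSpace ℝ (Fin 3) → EuclideanSpace ℝ (Fin 3)) (R : ℝ),
        YBound F R → (∃ R', XBound W R') → ContDiff ℝ 1 Q → Cob p β W Q → VectorCalculus.IsDivFree W →
        (∀ y, lerayLin (α0 p + β) (U k p β) W y + gradient Q y + b • Z p β y + ∑ j, c j • D p j y = F y) →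
        XBound W (C * Γ ^ κ * R) ∧ (∀ y, |Q y| ≤ C * Γ ^ κ * R) ∧ |b| ≤ C * Γ ^ κ * R ∧ ∀ j, |c j| ≤ C * Γ ^ κ * R)
    (h0 : ∃ (𝓚 : (Fin N → ℝ) → ℝ → (EuclideanSpace ℝ (Fin 3) → EuclideanSpace ℝ (Fin 3)) → EuclideanSpace ℝ (Fin 3) → EuclideanSpace ℝ (Fin 3)) (𝓠 : (Fin N → ℝ) → ℝ → (EuclideanSpace ℝ (Fin 3) → EuclideanSpace ℝ (Fin 3)) → EuclideanSpace ℝ (Fin 3) → ℝ)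
      (𝓫 : (Fin N → ℝ) → ℝ → (EuclideanSpace ℝ (Fin 3) → EuclideanSpace ℝ (Fin 3)) → ℝ) (𝓬 : (Fin N → ℝ) → ℝ → (EuclideanSpace ℝ (Fin 3) → EuclideanSpace ℝ (Fin 3)) → Fin N → ℝ),
      DefectGateSpecAcc N Γ κ C β₀ α0 (U 0) Z D 𝓚 𝓠 𝓫 𝓬 ∧
      ∀ p : Fin N → ℝ, (∀ i, p i ∈ Icc (0:ℝ) 1) → ∀ β : ℝ, |β| ≤ β₀ → ∀ F : EuclideanSpace ℝ (Fin 3) → EuclideanSpace ℝ (Fin 3), (∃ R, YBound F R) → Cob p β (𝓚 p β F) (𝓠 p β F)) :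
    ∃ (𝓚 : (Fin N → ℝ) → ℝ → (EuclideanSpace ℝ (Fin 3) → EuclideanSpace ℝ (Fin 3)) → EuclideanSpace ℝ (Fin 3) → EuclideanSpace ℝ (Fin 3)) (𝓠 : (Fin N → ℝ) → ℝ → (EuclideanSpace ℝ (Fin 3) → EuclideanSpace ℝ (Fin 3)) → EuclideanSpace ℝ (Fin 3) → ℝ)
      (𝓫 : (Fin N → ℝ) → ℝ → (EuclideanSpace ℝ (Fin 3) → EuclideanSpace ℝ (Fin 3)) → ℝ) (𝓬 : (Fin N → ℝ) → ℝ → (EuclideanSpace ℝ (Fin 3) → EuclideanSpace ℝ (Fin 3)) → Fin N → ℝ),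
      DefectGateSpecAcc N Γ κ C β₀ α0 (U n) Z D 𝓚 𝓠 𝓫 𝓬 ∧
      ∀ p : Fin N → ℝ, (∀ i, p i ∈ Icc (0:ℝ) 1) → ∀ β : ℝ, |β| ≤ β₀ → ∀ F : EuclideanSpace ℝ (Fin 3) → EuclideanSpace ℝ (Fin 3), (∃ R, YBound F R) → Cob p β (𝓚 p β F) (𝓠 p β F) := by
  -- induction on the step, carrying differentiability of the current base
  suffices H : ∀ k, k ≤ n →
      (∀ p : Fin N → ℝ, (∀ i, p i ∈ Icc (0:ℝ) 1) → ∀ β : ℝ, |β| ≤ β₀ → Differentiable ℝ (U k p β)) ∧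
      ∃ (𝓚 : (Fin N → ℝ) → ℝ → (EuclideanSpace ℝ (Fin 3) → EuclideanSpace ℝ (Fin 3)) → EuclideanSpace ℝ (Fin 3) → EuclideanSpace ℝ (Fin 3)) (𝓠 : (Fin N → ℝ) → ℝ → (EuclideanSpace ℝ (Fin 3) → EuclideanSpace ℝ (Fin 3)) → EuclideanSpace ℝ (Fin 3) → ℝ)
        (𝓫 : (Fin N → ℝ) → ℝ → (EuclideanSpace ℝ (Fin 3) → EuclideanSpace ℝ (Fin 3)) → ℝ) (𝓬 : (Fin N → ℝ) → ℝ → (EuclideanSpace ℝ (Fin 3) → EuclideanSpace ℝ (Fin 3)) → Fin N → ℝ),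
        DefectGateSpecAcc N Γ κ C β₀ α0 (U k) Z D 𝓚 𝓠 𝓫 𝓬 ∧
        ∀ p : Fin N → ℝ, (∀ i, p i ∈ Icc (0:ℝ) 1) → ∀ β : ℝ, |β| ≤ β₀ → ∀ F : EuclideanSpace ℝ (Fin 3) → EuclideanSpace ℝ (Fin 3), (∃ R, YBound F R) → Cob p β (𝓚 p β F) (𝓠 p β F) by
    exact (H n le_rfl).2
  intro k
  induction k with
  | zero => exact fun _ => ⟨hU0, h0⟩
  | succ k ih =>
    intro hk
    have hk' : k < n := Nat.lt_of_succ_le hk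
    obtain ⟨hUd, 𝓚, 𝓠, 𝓫, 𝓬, hg, hr⟩ := ih hk'.le
    -- the base at step `k+1` IS `U_k + V_k` on the box; off the box we do not care, so we transport along an auxiliary base
    set U' : (Fin N → ℝ) → ℝ → EuclideanSpace ℝ (Fin 3) → EuclideanSpace ℝ (Fin 3) := fun p β y => U k p β y + V k p β y with hU'
    -- one step
    obtain ⟨Nop, hN, hg'⟩ := DefectGateSpecAcc.perturb_base_range hg hUd (hV k hk') hν (hVc k hk')
    -- range transfer
    have hr' : ∀ p : Fin N → ℝ, (∀ i, p i ∈ Icc (0:ℝ) 1) → ∀ β : ℝ, |β| ≤ β₀ → ∀ F : EuclideanSpace ℝ (Fin 3) → EuclideanSpace ℝ (Fin 3), (∃ R, YBound F R) →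
        Cob p β (𝓚 p β (Nop (p, β) F)) (𝓠 p β (Nop (p, β) F)) := by
      intro p hp β hβ F hF
      obtain ⟨R, hFR⟩ := hF
      exact hr p hp β hβ (Nop (p, β) F) ⟨_, hN p hp β hβ F R hFR⟩
    -- the spec only looks at the box, where `U (k+1) = U'`: transport clause (1)'s equation
    have hg'' : DefectGateSpecAcc N Γ κ (2 * C) β₀ α0 (U (k + 1)) Z D (fun p β F => 𝓚 p β (Nop (p, β) F))
        (fun p β F => 𝓠 p β (Nop (p, β) F)) (fun p β F => 𝓫 p β (Nop (p, β) F)) (fun p β F => 𝓬 p β (Nop (p, β) F)) := by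
      obtain ⟨g12, g3, g4⟩ := hg'
      refine ⟨fun p hp β hβ => ⟨fun F R hF => ?_, (g12 p hp β hβ).2⟩, g3, g4⟩
      obtain ⟨hX, hQ1, hQb, hbb, hcb, hdiv, heq⟩ := (g12 p hp β hβ).1 F R hF
      have eU : U (k + 1) p β = fun y => U k p β y + V k p β y := funext (hstep k hk' p hp β hβ)
      refine ⟨hX, hQ1, hQb, hbb, hcb, hdiv, fun y => ?_⟩
      rw [eU]
      exact heq y
    -- reset the constant by the a-priori bound at `U (k+1)`
    have hreset := DefectGateSpecAcc.of_apriori hg'' Cob hr' (hap (k + 1) hk)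
    refine ⟨fun p hp β hβ => ?_, _, _, _, _, hreset, hr'⟩
    have eU : U (k + 1) p β = fun y => U k p β y + V k p β y := funext (hstep k hk' p hp β hβ)
    rw [eU]
    exact (hUd p hp β hβ).add ((hV k hk' p hp β hβ).1.differentiable (by norm_num))

/-! ## The straight chain `U⁰ + (k/n)·V` (appended by LEAD g14: the usable corollary) -/

/-- Local `C¹` closeness scales under a scalar multiple: `LocClose V′ V L ε ⇒ LocClose (c·V′) (c·V) L (|c|·ε)`. -/
theorem LocClose.const_smul {V V' : EuclideanSpace ℝ (Fin 3) → EuclideanSpace ℝ (Fin 3)} {L ε : ℝ} (h : LocClose V' V L ε) (c : ℝ)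
    (hV : Differentiable ℝ V) (hV' : Differentiable ℝ V') :
    LocClose (fun y => c • V' y) (fun y => c • V y) L (|c| * ε) := by
  intro y hy
  obtain ⟨h0, h1⟩ := h y hy
  refine ⟨?_, ?_⟩
  · rw [← smul_sub, norm_smul, Real.norm_eq_abs]
    exact mul_le_mul_of_nonneg_left h0 (abs_nonneg c)
  · rw [fderiv_fun_const_smul (hV' y), fderiv_fun_const_smul (hV y)]
    calc ‖c • fderiv ℝ V' y - c • fderiv ℝ V y‖ = ‖c • (fderiv ℝ V' y - fderiv ℝ V y)‖ := by rw [smul_sub]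
      _ = |c| * ‖fderiv ℝ V' y - fderiv ℝ V y‖ := by rw [norm_smul, Real.norm_eq_abs]
      _ ≤ |c| * ε := mul_le_mul_of_nonneg_left h1 (abs_nonneg c)

/-- **The continuity method along the straight chain `U_k = U⁰ + (k/n)·V`.**  A bordered gate with constant `C` and `Cob`-range at `U⁰`, a direction `V` X-bounded by `M`
and locally `(p,β)`-continuous on the box, a number of steps `n ≥ 1` with `8·CΓ^κ·M ≤ n`, and the a-priori bound with constant `C` for `Cob`-solutions of the bordered system at
every intermediate base `U⁰ + (k/n)·V`, `k ≤ n` ⇒ a bordered gate with constant `C` and `Cob`-range at `U⁰ + V`, all four clauses. -/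
theorem DefectGateSpecAcc.chain_linear {N : ℕ} {Γ κ C M β₀ : ℝ} {α0 : (Fin N → ℝ) → ℝ}
    {U0 V Z : (Fin N → ℝ) → ℝ → EuclideanSpace ℝ (Fin 3) → EuclideanSpace ℝ (Fin 3)} {D : (Fin N → ℝ) → Fin N → EuclideanSpace ℝ (Fin 3) → EuclideanSpace ℝ (Fin 3)} (n : ℕ) (hn : 1 ≤ n)
    (Cob : (Fin N → ℝ) → ℝ → (EuclideanSpace ℝ (Fin 3) → EuclideanSpace ℝ (Fin 3)) → (EuclideanSpace ℝ (Fin 3) → ℝ) → Prop)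
    (hU0 : ∀ p : Fin N → ℝ, (∀ i, p i ∈ Icc (0:ℝ) 1) → ∀ β : ℝ, |β| ≤ β₀ → Differentiable ℝ (U0 p β))
    (hV : ∀ p : Fin N → ℝ, (∀ i, p i ∈ Icc (0:ℝ) 1) → ∀ β : ℝ, |β| ≤ β₀ → XBound (V p β) M)
    (hM : 8 * (C * Γ ^ κ) * M ≤ n)
    (hVc : ∀ p : Fin N → ℝ, (∀ i, p i ∈ Icc (0:ℝ) 1) → ∀ β : ℝ, |β| ≤ β₀ → ∀ L ε : ℝ, 0 < ε → ∃ δ' : ℝ, 0 < δ' ∧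
      ∀ p' : Fin N → ℝ, (∀ i, p' i ∈ Icc (0:ℝ) 1) → ∀ β' : ℝ, |β'| ≤ β₀ → dist p' p < δ' → |β' - β| < δ' → LocClose (V p' β') (V p β) L ε)
    (hap : ∀ k, k ≤ n → ∀ p : Fin N → ℝ, (∀ i, p i ∈ Icc (0:ℝ) 1) → ∀ β : ℝ, |β| ≤ β₀ →
      ∀ (W : EuclideanSpace ℝ (Fin 3) → EuclideanSpace ℝ (Fin 3)) (Q : EuclideanSpace ℝ (Fin 3) → ℝ) (b : ℝ) (c : Fin N → ℝ) (F : EuclideanSpace ℝ (Fin 3) → EuclideanSpace ℝ (Fin 3)) (R : ℝ),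
        YBound F R → (∃ R', XBound W R') → ContDiff ℝ 1 Q → Cob p β W Q → VectorCalculus.IsDivFree W →
        (∀ y, lerayLin (α0 p + β) (fun y => U0 p β y + ((k:ℝ) / n) • V p β y) W y + gradient Q y + b • Z p β y + ∑ j, c j • D p j y = F y) →
        XBound W (C * Γ ^ κ * R) ∧ (∀ y, |Q y| ≤ C * Γ ^ κ * R) ∧ |b| ≤ C * Γ ^ κ * R ∧ ∀ j, |c j| ≤ C * Γ ^ κ * R)
    (h0 : ∃ (𝓚 : (Fin N → ℝ) → ℝ → (EuclideanSpace ℝ (Fin 3) → EuclideanSpace ℝ (Fin 3)) → EuclideanSpace ℝ (Fin 3) → EuclideanSpace ℝ (Fin 3)) (𝓠 : (Fin N → ℝ) → ℝ → (EuclideanSpace ℝ (Fin 3) → EuclideanSpace ℝ (Fin 3)) → EuclideanSpace ℝ (Fin 3) → ℝ)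
      (𝓫 : (Fin N → ℝ) → ℝ → (EuclideanSpace ℝ (Fin 3) → EuclideanSpace ℝ (Fin 3)) → ℝ) (𝓬 : (Fin N → ℝ) → ℝ → (EuclideanSpace ℝ (Fin 3) → EuclideanSpace ℝ (Fin 3)) → Fin N → ℝ),
      DefectGateSpecAcc N Γ κ C β₀ α0 U0 Z D 𝓚 𝓠 𝓫 𝓬 ∧
      ∀ p : Fin N → ℝ, (∀ i, p i ∈ Icc (0:ℝ) 1) → ∀ β : ℝ, |β| ≤ β₀ → ∀ F : EuclideanSpace ℝ (Fin 3) → EuclideanSpace ℝ (Fin 3), (∃ R, YBound F R) → Cob p β (𝓚 p β F) (𝓠 p β F)) :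
    ∃ (𝓚 : (Fin N → ℝ) → ℝ → (EuclideanSpace ℝ (Fin 3) → EuclideanSpace ℝ (Fin 3)) → EuclideanSpace ℝ (Fin 3) → EuclideanSpace ℝ (Fin 3)) (𝓠 : (Fin N → ℝ) → ℝ → (EuclideanSpace ℝ (Fin 3) → EuclideanSpace ℝ (Fin 3)) → EuclideanSpace ℝ (Fin 3) → ℝ)
      (𝓫 : (Fin N → ℝ) → ℝ → (EuclideanSpace ℝ (Fin 3) → EuclideanSpace ℝ (Fin 3)) → ℝ) (𝓬 : (Fin N → ℝ) → ℝ → (EuclideanSpace ℝ (Fin 3) → EuclideanSpace ℝ (Fin 3)) → Fin N → ℝ),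
      DefectGateSpecAcc N Γ κ C β₀ α0 (fun p β y => U0 p β y + V p β y) Z D 𝓚 𝓠 𝓫 𝓬 ∧
      ∀ p : Fin N → ℝ, (∀ i, p i ∈ Icc (0:ℝ) 1) → ∀ β : ℝ, |β| ≤ β₀ → ∀ F : EuclideanSpace ℝ (Fin 3) → EuclideanSpace ℝ (Fin 3), (∃ R, YBound F R) → Cob p β (𝓚 p β F) (𝓠 p β F) := by
  have hn0 : (0:ℝ) < n := by exact_mod_cast hn
  -- the chain and its increments
  set U : ℕ → (Fin N → ℝ) → ℝ → EuclideanSpace ℝ (Fin 3) → EuclideanSpace ℝ (Fin 3) := fun k p β y => U0 p β y + ((k:ℝ) / n) • V p β y with hU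
  set Vs : ℕ → (Fin N → ℝ) → ℝ → EuclideanSpace ℝ (Fin 3) → EuclideanSpace ℝ (Fin 3) := fun _ p β y => ((1:ℝ) / n) • V p β y with hVs
  have hstep : ∀ k, k < n → ∀ p : Fin N → ℝ, (∀ i, p i ∈ Icc (0:ℝ) 1) → ∀ β : ℝ, |β| ≤ β₀ → ∀ y, U (k + 1) p β y = U k p β y + Vs k p β y := by
    intro k _ p _ β _ y
    simp only [hU, hVs, Nat.cast_succ]
    rw [add_div, add_smul, add_assoc]
  have hU0' : ∀ p : Fin N → ℝ, (∀ i, p i ∈ Icc (0:ℝ) 1) → ∀ β : ℝ, |β| ≤ β₀ → Differentiable ℝ (U 0 p β) := by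
    intro p hp β hβ
    have e : U 0 p β = U0 p β := by funext y; simp [hU]
    rw [e]; exact hU0 p hp β hβ
  have hν : 8 * (C * Γ ^ κ) * (|(1:ℝ) / n| * M) ≤ 1 := by
    rw [abs_of_pos (by positivity), show 8 * (C * Γ ^ κ) * (1 / (n:ℝ) * M) = (8 * (C * Γ ^ κ) * M) / n by ring]
    exact (div_le_one hn0).mpr hM
  have hV' : ∀ k, k < n → ∀ p : Fin N → ℝ, (∀ i, p i ∈ Icc (0:ℝ) 1) → ∀ β : ℝ, |β| ≤ β₀ → XBound (Vs k p β) (|(1:ℝ) / n| * M) :=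
    fun k _ p hp β hβ => (hV p hp β hβ).smul _
  have hVc' : ∀ k, k < n → ∀ p : Fin N → ℝ, (∀ i, p i ∈ Icc (0:ℝ) 1) → ∀ β : ℝ, |β| ≤ β₀ → ∀ L ε : ℝ, 0 < ε → ∃ δ' : ℝ, 0 < δ' ∧
      ∀ p' : Fin N → ℝ, (∀ i, p' i ∈ Icc (0:ℝ) 1) → ∀ β' : ℝ, |β'| ≤ β₀ → dist p' p < δ' → |β' - β| < δ' → LocClose (Vs k p' β') (Vs k p β) L ε := by
    intro k _ p hp β hβ L ε hε
    obtain ⟨δ', hδ', h⟩ := hVc p hp β hβ L ε hε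
    refine ⟨δ', hδ', fun p' hp' β' hβ' hd hdβ => ?_⟩
    have hl := LocClose.const_smul (h p' hp' β' hβ' hd hdβ) ((1:ℝ) / n) ((hV p hp β hβ).1.differentiable (by norm_num))
      ((hV p' hp' β' hβ').1.differentiable (by norm_num))
    have hle : |(1:ℝ) / n| * ε ≤ ε := by
      rw [abs_of_pos (by positivity)]
      have : (1:ℝ) / n ≤ 1 := (div_le_one hn0).mpr (by exact_mod_cast hn)
      nlinarith
    exact fun y hy => ⟨((hl y hy).1).trans hle, ((hl y hy).2).trans hle⟩
  have hap' : ∀ k, k ≤ n → ∀ p : Fin N → ℝ, (∀ i, p i ∈ Icc (0:ℝ) 1) → ∀ β : ℝ, |β| ≤ β₀ →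
      ∀ (W : EuclideanSpace ℝ (Fin 3) → EuclideanSpace ℝ (Fin 3)) (Q : EuclideanSpace ℝ (Fin 3) → ℝ) (b : ℝ) (c : Fin N → ℝ) (F : EuclideanSpace ℝ (Fin 3) → EuclideanSpace ℝ (Fin 3)) (R : ℝ),
        YBound F R → (∃ R', XBound W R') → ContDiff ℝ 1 Q → Cob p β W Q → VectorCalculus.IsDivFree W →
        (∀ y, lerayLin (α0 p + β) (U k p β) W y + gradient Q y + b • Z p β y + ∑ j, c j • D p j y = F y) →
        XBound W (C * Γ ^ κ * R) ∧ (∀ y, |Q y| ≤ C * Γ ^ κ * R) ∧ |b| ≤ C * Γ ^ κ * R ∧ ∀ j, |c j| ≤ C * Γ ^ κ * R :=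
    fun k hk => hap k hk
  obtain ⟨𝓚, 𝓠, 𝓫, 𝓬, hg, hr⟩ := DefectGateSpecAcc.chain U Vs n Cob hstep hU0' hV' hν hVc' hap'
    (by
      obtain ⟨𝓚, 𝓠, 𝓫, 𝓬, hg, hr⟩ := h0
      have e : U 0 = U0 := by funext p β y; simp [hU]
      exact ⟨𝓚, 𝓠, 𝓫, 𝓬, by rw [e]; exact hg, hr⟩)
  have e : U n = fun p β y => U0 p β y + V p β y := by
    funext p β y; simp [hU, div_self (ne_of_gt hn0)]
  exact ⟨𝓚, 𝓠, 𝓫, 𝓬, by rw [← e]; exact hg, hr⟩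

end Summit.NavierStokesRegularity.NavierStokesRegularity.Theorems.DefectColumnGate

end
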